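import Summits.Ventures.PercRepro.ProfilePointedUnifOdd

/-!
# PercRepro — THE ODD CASE, SUMMED: `P_k(N) = Σ_{T₀} P_{k−s}(M(T₀, f T₀))` AND THE EXTENSION COUNTS
(p10, gen 24; unconditional)

Every bi-independent set of `N` meets the `U_{s+1,2s+1}`-restriction `L` in an `s`-subset `T₀` or in the complement
`L ∖ T₀` of one (ProfilePointedUnifOdd); grouping the bi-independent `k`-sets by that `T₀` (`oddTrace`,
`card_eq_sum_card_fiberwise`) and using the two fibre bijections gives
`P_k(N) = Σ_{T₀ ∈ (L choose s)} P_{k−s}(M(T₀, f T₀))` (`card_biIndepSets_odd`) for any choice of `f T₀ ∈ L ∖ T₀`.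
The same bijections carry the `p`-extendable sets: for `p ∉ L`, `c^p_k(N) = Σ_{T₀} c^p_{k−s}(M(T₀, f T₀))`
(`extCount_odd`; `(X ∪ p) ∩ L = X ∩ L`); for `p ∈ L` an extendable set has trace an `s`-subset `T₀ ∌ p` (its extension
by `p` meets `L` in `s + 1` elements, so the trace cannot already have `s + 1`), and, once `X = Z ∪ T₀` is bi-independent,
`X ∪ p` is bi-independent in `N` iff `Z ∪ p` is in `M(T₀, p)` (`insert_union_mem_biIndepSets_odd_iff`: the complement
conditions are automatic), so `c^p_k(N) = Σ_{T₀ ∌ p} c^p_{k−s}(M(T₀, p))` (`extCount_odd_mem`).  Nothing here asserts (Ĉ).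
-/

open scoped Matroid

namespace PercRepro.Cogirth

open Finset ThmH Skew

variable {α : Type} [DecidableEq α] {N : Matroid α} [N.Finite]

section oddsum

variable {L : Finset α} {s : ℕ}

/-- The `s`-subset of `L` attached to a set `X`: its trace `X ∩ L` if that has `s` elements, else `L ∖ (X ∩ L)`. -/
def oddTrace (L : Finset α) (s : ℕ) (X : Finset α) : Finset α :=
  if (X ∩ L).card = s then X ∩ L else L \ (X ∩ L)

/-- `oddTrace` when the trace has `s` elements: the trace itself. -/
theorem oddTrace_of_card_eq {X : Finset α} (h : (X ∩ L).card = s) : oddTrace L s X = X ∩ L := by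
  unfold oddTrace
  rw [if_pos h]

/-- `oddTrace` when the trace does not have `s` elements: the complement of the trace in `L`. -/
theorem oddTrace_of_card_ne {X : Finset α} (h : (X ∩ L).card ≠ s) : oddTrace L s X = L \ (X ∩ L) := by
  unfold oddTrace
  rw [if_neg h]

/-- The attached `s`-subset of a bi-independent set is an `s`-subset of `L`. -/
theorem oddTrace_mem (hL : OddRestriction N L s) {k : ℕ} {X : Finset α} (hX : X ∈ biIndepSets N k) :
    oddTrace L s X ∈ L.powersetCard s := by
  rcases card_inter_eq_or_of_mem_biIndepSets hL hX with h | h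
  · rw [oddTrace_of_card_eq h]
    exact mem_powersetCard.2 ⟨inter_subset_right, h⟩
  · rw [oddTrace_of_card_ne (by omega)]
    exact mem_powersetCard.2 ⟨sdiff_subset, by rw [card_sdiff_of_subset inter_subset_right, hL.card_eq, h]; omega⟩

/-- The fibre of `oddTrace` over `T₀`, on the bi-independent sets: trace `T₀` or trace `L ∖ T₀`. -/
theorem oddTrace_eq_iff (hL : OddRestriction N L s) {k : ℕ} {X : Finset α} (hX : X ∈ biIndepSets N k)
    {T₀ : Finset α} (hT₀ : T₀ ∈ L.powersetCard s) :
    oddTrace L s X = T₀ ↔ X ∩ L = T₀ ∨ X ∩ L = L \ T₀ := by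
  obtain ⟨hT₀L, hT₀c⟩ := mem_powersetCard.1 hT₀
  rcases card_inter_eq_or_of_mem_biIndepSets hL hX with h | h
  · rw [oddTrace_of_card_eq h]
    constructor
    · exact fun h' => Or.inl h'
    · rintro (h' | h')
      · exact h'
      · have := congrArg Finset.card h'
        rw [h, card_sdiff_of_subset hT₀L, hL.card_eq, hT₀c] at this
        omega
  · rw [oddTrace_of_card_ne (by omega)]
    constructor
    · intro h'
      right
      rw [← h', Finset.sdiff_sdiff_eq_self inter_subset_right]
    · rintro (h' | h')
      · have := congrArg Finset.card h'
        rw [h, hT₀c] at this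
        omega
      · rw [h', Finset.sdiff_sdiff_eq_self hT₀L]

/-- **The profile splits off a `U_{s+1,2s+1}`-restriction as a sum over its `s`-subsets** (unconditional): for
`s ≤ k` and any choice `f T₀ ∈ L ∖ T₀`, `P_k(N) = Σ_{T₀ ∈ (L choose s)} P_{k−s}(M(T₀, f T₀))`. -/
theorem card_biIndepSets_odd (hL : OddRestriction N L s) (f : Finset α → α)
    (hf : ∀ T₀ ∈ L.powersetCard s, f T₀ ∈ L ∧ f T₀ ∉ T₀) {k : ℕ} (hk : s ≤ k) :
    (biIndepSets N k).card =
      ∑ T₀ ∈ L.powersetCard s, (biIndepSets (oddMinor N L T₀ (f T₀)) (k - s)).card := by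
  rw [card_eq_sum_card_fiberwise (f := oddTrace L s) (t := L.powersetCard s)
    (fun X hX => oddTrace_mem hL hX)]
  apply sum_congr rfl
  intro T₀ hT₀
  obtain ⟨hfL, hfT⟩ := hf T₀ hT₀
  rw [filter_congr (fun X hX => oddTrace_eq_iff hL hX hT₀), filter_or, card_union_of_disjoint,
    card_filter_biIndepSets_odd_low hL hT₀ hfL hfT hk, card_filter_biIndepSets_odd_high hL hT₀ hfL hfT hk,
    add_comm, card_filter_add_card_filter_not]
  rw [disjoint_left]
  intro X h1 h2
  rw [mem_filter] at h1 h2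
  have := h2.2 ▸ h1.2
  obtain ⟨hT₀L, hT₀c⟩ := mem_powersetCard.1 hT₀
  have := congrArg Finset.card this
  rw [card_sdiff_of_subset hT₀L, hL.card_eq, hT₀c] at this
  omega

/-! ### The extension counts -/

/-- For `p ∉ L` the extension by `p` commutes with the trace and with `X ↦ X ∖ L`. -/
theorem insert_inter_sdiff {p : α} (hpL : p ∉ L) (X : Finset α) :
    insert p X ∩ L = X ∩ L ∧ insert p X \ L = insert p (X \ L) :=
  ⟨insert_inter_of_notMem hpL, insert_sdiff_of_notMem X hpL⟩

/-- **The extension counts split off the restriction, `p ∉ L`**: for `s ≤ k` and any choice `f T₀ ∈ L ∖ T₀`,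
`c^p_k(N) = Σ_{T₀} c^p_{k−s}(M(T₀, f T₀))`. -/
theorem extCount_odd (hL : OddRestriction N L s) (f : Finset α → α)
    (hf : ∀ T₀ ∈ L.powersetCard s, f T₀ ∈ L ∧ f T₀ ∉ T₀) {p : α} (hp : p ∈ gr N) (hpL : p ∉ L) {k : ℕ}
    (hk : s ≤ k) :
    extCount N k p = ∑ T₀ ∈ L.powersetCard s, extCount (oddMinor N L T₀ (f T₀)) (k - s) p := by
  unfold extCount
  rw [card_eq_sum_card_fiberwise (f := oddTrace L s) (t := L.powersetCard s)
    (fun X hX => oddTrace_mem hL (mem_filter.1 hX).1)]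
  apply sum_congr rfl
  intro T₀ hT₀
  obtain ⟨hfL, hfT⟩ := hf T₀ hT₀
  obtain ⟨hT₀L, hT₀c⟩ := mem_powersetCard.1 hT₀
  have hgr := gr_oddMinor (N := N) hT₀L hfT
  rw [filter_filter, filter_congr (fun X hX => and_congr_right (fun _ => oddTrace_eq_iff hL hX hT₀)),
    filter_congr (fun X (_ : X ∈ biIndepSets N k) => and_or_left), filter_or, card_union_of_disjoint]
  · -- low and high fibres, with the extension condition carried along
    have hlow : ((biIndepSets N k).filter
        (fun X => (p ∉ X ∧ insert p X ∈ biIndepSets N (k + 1)) ∧ X ∩ L = T₀)).card =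
        (((biIndepSets (oddMinor N L T₀ (f T₀)) (k - s)).filter
          (fun Z => p ∉ Z ∧ insert p Z ∈ biIndepSets (oddMinor N L T₀ (f T₀)) (k - s + 1))).filter
            (fun Z => f T₀ ∉ Z)).card := by
      apply card_bij (fun X _ => X \ L)
      · intro X hX
        rw [mem_filter] at hX
        rw [mem_filter, mem_filter]
        obtain ⟨hX, ⟨hpX, hins⟩, hXL⟩ := hX
        have hZ : X \ L ⊆ gr N \ L := sdiff_subset_sdiff (mem_biIndepSets.1 hX).1 (subset_refl L)
        have hZ' : insert p (X \ L) ⊆ gr N \ L := insert_subset (mem_sdiff.2 ⟨hp, hpL⟩) hZ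
        refine ⟨⟨?_, fun h => hpX (mem_sdiff.1 h).1, ?_⟩, fun h => (mem_sdiff.1 h).2 hfL⟩
        · rw [← union_mem_biIndepSets_odd_low_iff hL hT₀ hfL hfT hk hZ, ← hXL, sdiff_union_inter]
          exact hX
        · rw [show k - s + 1 = k + 1 - s by omega,
            ← union_mem_biIndepSets_odd_low_iff hL hT₀ hfL hfT (by omega) hZ', ← (insert_inter_sdiff hpL X).2,
            ← hXL, ← (insert_inter_sdiff hpL X).1, sdiff_union_inter]
          exact hins
      · intro X hX Y hY h
        rw [mem_filter] at hX hY
        rw [← sdiff_union_inter X L, ← sdiff_union_inter Y L, h, hX.2.2, hY.2.2]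
      · intro Z hZ
        rw [mem_filter, mem_filter] at hZ
        obtain ⟨⟨hZ, hpZ, hins⟩, hfZ⟩ := hZ
        have hZg : Z ⊆ gr N \ L := by
          intro x hx
          have := (mem_biIndepSets.1 hZ).1 hx
          rw [hgr, mem_sdiff] at this
          exact mem_sdiff.2 ⟨this.1, fun hxL => this.2 (mem_erase.2 ⟨fun h => hfZ (h ▸ hx), hxL⟩)⟩
        have hZL : Disjoint Z L := disjoint_left.2 (fun x hx hxL => (mem_sdiff.1 (hZg hx)).2 hxL)
        have hZg' : insert p Z ⊆ gr N \ L := insert_subset (mem_sdiff.2 ⟨hp, hpL⟩) hZg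
        have e1 : (Z ∪ T₀) \ L = Z := by
          ext x
          simp only [mem_sdiff, mem_union]
          constructor
          · rintro ⟨hx | hx, hxL⟩
            · exact hx
            · exact absurd (hT₀L hx) hxL
          · intro hx
            exact ⟨Or.inl hx, disjoint_left.1 hZL hx⟩
        refine ⟨Z ∪ T₀, ?_, e1⟩
        rw [mem_filter]
        refine ⟨?_, ⟨?_, ?_⟩, ?_⟩
        · rw [union_mem_biIndepSets_odd_low_iff hL hT₀ hfL hfT hk hZg]
          exact hZ
        · exact fun h => (mem_union.1 h).elim hpZ (fun h' => hpL (hT₀L h'))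
        · rw [← insert_union, union_mem_biIndepSets_odd_low_iff hL hT₀ hfL hfT (by omega) hZg',
            show k + 1 - s = k - s + 1 by omega]
          exact hins
        · rw [union_inter_distrib_right, disjoint_iff_inter_eq_empty.1 hZL, empty_union, inter_eq_left.2 hT₀L]
    have hhigh : ((biIndepSets N k).filter
        (fun X => (p ∉ X ∧ insert p X ∈ biIndepSets N (k + 1)) ∧ X ∩ L = L \ T₀)).card =
        (((biIndepSets (oddMinor N L T₀ (f T₀)) (k - s)).filter
          (fun Z => p ∉ Z ∧ insert p Z ∈ biIndepSets (oddMinor N L T₀ (f T₀)) (k - s + 1))).filter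
            (fun Z => f T₀ ∈ Z)).card := by
      have hpf : p ≠ f T₀ := fun h => hpL (h ▸ hfL)
      apply card_bij (fun X _ => insert (f T₀) (X \ L))
      · intro X hX
        rw [mem_filter] at hX
        rw [mem_filter, mem_filter]
        obtain ⟨hX, ⟨hpX, hins⟩, hXL⟩ := hX
        have hZ : X \ L ⊆ gr N \ L := sdiff_subset_sdiff (mem_biIndepSets.1 hX).1 (subset_refl L)
        have hZ' : insert p (X \ L) ⊆ gr N \ L := insert_subset (mem_sdiff.2 ⟨hp, hpL⟩) hZ
        refine ⟨⟨?_, ?_, ?_⟩, mem_insert_self _ _⟩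
        · rw [← union_mem_biIndepSets_odd_high_iff hL hT₀ hfL hfT hk hZ, ← hXL, sdiff_union_inter]
          exact hX
        · intro h
          rcases mem_insert.1 h with h | h
          · exact hpf h
          · exact hpX (mem_sdiff.1 h).1
        · rw [insert_comm, show k - s + 1 = k + 1 - s by omega,
            ← union_mem_biIndepSets_odd_high_iff hL hT₀ hfL hfT (by omega) hZ', ← (insert_inter_sdiff hpL X).2,
            ← hXL, ← (insert_inter_sdiff hpL X).1, sdiff_union_inter]
          exact hins
      · intro X hX Y hY h
        rw [mem_filter] at hX hY
        have hfX : f T₀ ∉ X \ L := fun h' => (mem_sdiff.1 h').2 hfL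
        have hfY : f T₀ ∉ Y \ L := fun h' => (mem_sdiff.1 h').2 hfL
        have h' : X \ L = Y \ L := by
          rw [← erase_insert hfX, ← erase_insert hfY, h]
        rw [← sdiff_union_inter X L, ← sdiff_union_inter Y L, h', hX.2.2, hY.2.2]
      · intro Z' hZ'
        rw [mem_filter, mem_filter] at hZ'
        obtain ⟨⟨hZ', hpZ', hins⟩, hfZ'⟩ := hZ'
        set Z := Z'.erase (f T₀) with hZdef
        have hZ'e : Z' = insert (f T₀) Z := (insert_erase hfZ').symm
        have hfZ : f T₀ ∉ Z := notMem_erase (f T₀) Z'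
        have hZg : Z ⊆ gr N \ L := by
          intro x hx
          have hxZ' : x ∈ Z' := mem_of_mem_erase hx
          have := (mem_biIndepSets.1 hZ').1 hxZ'
          rw [hgr, mem_sdiff] at this
          exact mem_sdiff.2 ⟨this.1, fun hxL => this.2 (mem_erase.2 ⟨fun h => hfZ (h ▸ hx), hxL⟩)⟩
        have hZL : Disjoint Z L := disjoint_left.2 (fun x hx hxL => (mem_sdiff.1 (hZg hx)).2 hxL)
        have hZg' : insert p Z ⊆ gr N \ L := insert_subset (mem_sdiff.2 ⟨hp, hpL⟩) hZg
        have hpZ : p ∉ Z := fun h => hpZ' (mem_of_mem_erase h)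
        have e1 : (Z ∪ (L \ T₀)) \ L = Z := by
          ext x
          simp only [mem_sdiff, mem_union]
          constructor
          · rintro ⟨hx | hx, hxL⟩
            · exact hx
            · exact absurd hx.1 hxL
          · intro hx
            exact ⟨Or.inl hx, disjoint_left.1 hZL hx⟩
        refine ⟨Z ∪ (L \ T₀), ?_, by rw [e1, ← hZ'e]⟩
        rw [mem_filter]
        refine ⟨?_, ⟨?_, ?_⟩, ?_⟩
        · rw [union_mem_biIndepSets_odd_high_iff hL hT₀ hfL hfT hk hZg, ← hZ'e]
          exact hZ'
        · exact fun h => (mem_union.1 h).elim hpZ (fun h' => hpL (mem_sdiff.1 h').1)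
        · rw [← insert_union, union_mem_biIndepSets_odd_high_iff hL hT₀ hfL hfT (by omega) hZg',
            show k + 1 - s = k - s + 1 by omega, insert_comm, ← hZ'e]
          exact hins
        · rw [union_inter_distrib_right, disjoint_iff_inter_eq_empty.1 hZL, empty_union,
            inter_eq_left.2 sdiff_subset]
    rw [hlow, hhigh, add_comm, card_filter_add_card_filter_not]
  · rw [disjoint_left]
    intro X h1 h2
    rw [mem_filter] at h1 h2
    have := h2.2.2 ▸ h1.2.2
    have := congrArg Finset.card this
    rw [card_sdiff_of_subset hT₀L, hL.card_eq, hT₀c] at this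
    omega

/-- For `p ∈ L ∖ T₀` and `Z ∪ T₀` bi-independent: `Z ∪ T₀ ∪ p` is bi-independent in `N` iff `Z ∪ p` is bi-independent
in `M(T₀, p)` (the complement conditions are automatic). -/
theorem insert_union_mem_biIndepSets_odd_iff (hL : OddRestriction N L s) {T₀ : Finset α}
    (hT₀ : T₀ ∈ L.powersetCard s) {p : α} (hpL : p ∈ L) (hpT : p ∉ T₀) {k : ℕ} (hk : s ≤ k) {Z : Finset α}
    (hZ : Z ⊆ gr N \ L) (hZT : Z ∪ T₀ ∈ biIndepSets N k) :
    insert p (Z ∪ T₀) ∈ biIndepSets N (k + 1) ↔ insert p Z ∈ biIndepSets (oddMinor N L T₀ p) (k - s + 1) := by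
  obtain ⟨hT₀L, hT₀c⟩ := mem_powersetCard.1 hT₀
  have hgr := gr_oddMinor (N := N) hT₀L hpT
  have hp : p ∈ gr N := hL.subset_gr hpL
  have hZL : Disjoint Z L := disjoint_left.2 (fun x hx hxL => (mem_sdiff.1 (hZ hx)).2 hxL)
  have hpZ : p ∉ Z := disjoint_right.1 hZL hpL
  have hZg : insert p Z ⊆ gr N \ L.erase p :=
    insert_subset (mem_sdiff.2 ⟨hp, fun h => (mem_erase.1 h).1 rfl⟩)
      (hZ.trans (sdiff_subset_sdiff (subset_refl _) (erase_subset p L)))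
  have hTp : insert p T₀ ∈ L.powersetCard (s + 1) :=
    mem_powersetCard.2 ⟨insert_subset hpL hT₀L, by rw [card_insert_of_notMem hpT, hT₀c]⟩
  have hLT : L \ T₀ ∈ L.powersetCard (s + 1) :=
    mem_powersetCard.2 ⟨sdiff_subset, by rw [card_sdiff_of_subset hT₀L, hL.card_eq, hT₀c]; omega⟩
  set W := (gr N \ L) \ Z with hW
  have hWL : Disjoint W L := disjoint_of_subset_left sdiff_subset sdiff_disjoint
  have hWg : W ⊆ gr N \ L.erase p := by
    rw [hW, ← sdiff_erase_sdiff_insert_eq hpL]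
    exact sdiff_subset
  -- from `Z ∪ T₀` bi-independent: `W ∪ (L ∖ T₀)` is independent, hence `W ∪ T₀ ∪ p` and its subsets
  have hWc : rk N (W ∪ (L \ T₀)) = (W ∪ (L \ T₀)).card := by
    have := (mem_biIndepSets.1 hZT).2.2.2
    rwa [sdiff_union_eq_sdiff_sdiff_union hL.subset_gr hT₀L hZL] at this
  have hWp : rk N (W ∪ insert p T₀) = (W ∪ insert p T₀).card :=
    (rk_union_eq_card_iff_odd hL hWL hLT hTp).1 hWc
  have hWT : rk N (W ∪ T₀) = (W ∪ T₀).card :=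
    rk_eq_card_of_subset_of_rk_eq_card (union_subset_union_right (subset_insert p T₀)) hWp
  have hWT' : rk N (W ∪ (L \ insert p T₀)) = (W ∪ (L \ insert p T₀)).card :=
    rk_eq_card_of_subset_of_rk_eq_card
      (union_subset_union_right (sdiff_subset_sdiff (subset_refl L) (subset_insert p T₀))) hWc
  have e1 : insert p (Z ∪ T₀) = Z ∪ insert p T₀ := by
    ext x
    simp only [mem_insert, mem_union]
    tauto
  have e2 : insert p Z ∪ T₀ = Z ∪ insert p T₀ := by
    ext x
    simp only [mem_insert, mem_union]
    tauto
  rw [e1, mem_biIndepSets, mem_biIndepSets, hgr, sdiff_erase_sdiff_insert_eq hpL,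
    rk_oddMinor_eq_card_iff hL hT₀ hpT hZg, rk_oddMinor_eq_card_iff hL hT₀ hpT hWg, e2,
    sdiff_union_eq_sdiff_sdiff_union hL.subset_gr (insert_subset hpL hT₀L) hZL, ← hW,
    card_insert_of_notMem hpZ, card_union_of_disjoint (disjoint_of_subset_right (insert_subset hpL hT₀L) hZL),
    card_insert_of_notMem hpT, hT₀c]
  constructor
  · rintro ⟨-, hk', h1, -⟩
    exact ⟨hZg, by omega, h1, hWT⟩
  · rintro ⟨-, hk', h1, -⟩
    exact ⟨union_subset (hZ.trans sdiff_subset) ((insert_subset hpL hT₀L).trans hL.subset_gr), by omega, h1,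
      hWT'⟩

/-- **The extension counts at a point of the restriction**: for `p ∈ L` and `s ≤ k`,
`c^p_k(N) = Σ_{T₀ ∌ p} c^p_{k−s}(M(T₀, p))` over the `s`-subsets `T₀` of `L` avoiding `p`. -/
theorem extCount_odd_mem (hL : OddRestriction N L s) {p : α} (hpL : p ∈ L) {k : ℕ} (hk : s ≤ k) :
    extCount N k p =
      ∑ T₀ ∈ (L.powersetCard s).filter (fun T₀ => p ∉ T₀), extCount (oddMinor N L T₀ p) (k - s) p := by
  unfold extCount
  have hp : p ∈ gr N := hL.subset_gr hpL
  -- every extendable set has trace an `s`-subset avoiding `p`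
  have htrace : ∀ X ∈ (biIndepSets N k).filter (fun X => p ∉ X ∧ insert p X ∈ biIndepSets N (k + 1)),
      (X ∩ L).card = s ∧ p ∉ X ∩ L := by
    intro X hX
    rw [mem_filter] at hX
    obtain ⟨hX, hpX, hins⟩ := hX
    have h1 := card_inter_eq_or_of_mem_biIndepSets hL hins
    have h2 := card_inter_eq_or_of_mem_biIndepSets hL hX
    rw [insert_inter_of_mem hpL, card_insert_of_notMem (fun h => hpX (mem_inter.1 h).1)] at h1
    exact ⟨by omega, fun h => hpX (mem_inter.1 h).1⟩
  rw [card_eq_sum_card_fiberwise (f := fun X => X ∩ L) (t := (L.powersetCard s).filter (fun T₀ => p ∉ T₀))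
    (fun X hX => mem_filter.2 ⟨mem_powersetCard.2 ⟨inter_subset_right, (htrace X hX).1⟩, (htrace X hX).2⟩)]
  apply sum_congr rfl
  intro T₀ hT₀
  rw [mem_filter] at hT₀
  obtain ⟨hT₀, hpT⟩ := hT₀
  obtain ⟨hT₀L, hT₀c⟩ := mem_powersetCard.1 hT₀
  have hgr := gr_oddMinor (N := N) hT₀L hpT
  rw [filter_filter]
  apply card_bij (fun X _ => X \ L)
  · intro X hX
    rw [mem_filter] at hX ⊢
    obtain ⟨hX, ⟨hpX, hins⟩, hXL⟩ := hX
    have hZ : X \ L ⊆ gr N \ L := sdiff_subset_sdiff (mem_biIndepSets.1 hX).1 (subset_refl L)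
    have hXe : X = X \ L ∪ T₀ := by rw [← hXL, sdiff_union_inter]
    have hZT : X \ L ∪ T₀ ∈ biIndepSets N k := hXe ▸ hX
    refine ⟨(union_mem_biIndepSets_odd_low_iff hL hT₀ hpL hpT hk hZ).1 hZT, fun h => hpX (mem_sdiff.1 h).1, ?_⟩
    rw [← insert_union_mem_biIndepSets_odd_iff hL hT₀ hpL hpT hk hZ hZT, ← hXe]
    exact hins
  · intro X hX Y hY h
    rw [mem_filter] at hX hY
    rw [← sdiff_union_inter X L, ← sdiff_union_inter Y L, h, hX.2.2, hY.2.2]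
  · intro Z hZ
    rw [mem_filter] at hZ
    obtain ⟨hZ, hpZ, hins⟩ := hZ
    have hZg : Z ⊆ gr N \ L := by
      intro x hx
      have := (mem_biIndepSets.1 hZ).1 hx
      rw [hgr, mem_sdiff] at this
      exact mem_sdiff.2 ⟨this.1, fun hxL => this.2 (mem_erase.2 ⟨fun h => hpZ (h ▸ hx), hxL⟩)⟩
    have hZL : Disjoint Z L := disjoint_left.2 (fun x hx hxL => (mem_sdiff.1 (hZg hx)).2 hxL)
    have hZT : Z ∪ T₀ ∈ biIndepSets N k := (union_mem_biIndepSets_odd_low_iff hL hT₀ hpL hpT hk hZg).2 hZ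
    have e1 : (Z ∪ T₀) \ L = Z := by
      ext x
      simp only [mem_sdiff, mem_union]
      constructor
      · rintro ⟨hx | hx, hxL⟩
        · exact hx
        · exact absurd (hT₀L hx) hxL
      · intro hx
        exact ⟨Or.inl hx, disjoint_left.1 hZL hx⟩
    refine ⟨Z ∪ T₀, ?_, e1⟩
    rw [mem_filter]
    refine ⟨hZT, ⟨fun h => (mem_union.1 h).elim hpZ hpT, ?_⟩, ?_⟩
    · rw [insert_union_mem_biIndepSets_odd_iff hL hT₀ hpL hpT hk hZg hZT]
      exact hins
    · rw [union_inter_distrib_right, disjoint_iff_inter_eq_empty.1 hZL, empty_union, inter_eq_left.2 hT₀L]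

end oddsum

end PercRepro.Cogirth
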